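import Mathlib
import Summits.KontsevichZagierPeriods.Zeta5Search.BrickLevelReduction
import Summits.KontsevichZagierPeriods.Zeta5Search.BrickLambdaDigit
import Summits.KontsevichZagierPeriods.Zeta5Search.BrickLambdaLocality
import Summits.KontsevichZagierPeriods.Zeta5Search.BrickDigitSide

/-!
# BrickBlockWeight — THEOREM 8, the DEGREE-ZERO BLOCK WEIGHT is `p` times an admissible weight one level down:
`W(K) ≡ 0 (mod p)`, `W(N−K) + W(K) ≡ 0 (mod p^{L+1})`, `W(K') ≡ W(K) (mod p^{e+1})` for `K' ≡ K (mod p^e)`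
(zi-p2 PROPOSITION H° steps (3)–(4) and DIGIT THEOREM steps (a)–(b); cell zeta5-irr)

HONEST FRAMING: systematic search; no irrationality claim unless certified. INSTRUMENT lemmas of the ζ(5)
census cell zeta5-irr (HOME `run/shared/lean/pub/zeta5-irr/`; memo `zi-p2/probes/B8/thm8/THEOREM8.md` §2:
«(3) W° ≡ 0 (mod p): … W°(k′) ≡ Σ_{k₀≤M₀} g(k₀)c̃_{k₀,A}(M₀) =: S₀ (mod p) by (D)₁ and (°), and S₀ ≡ −S₀ …
(4) ω° IS ADMISSIBLE for M′ at level ℓ−1: … (S_{ℓ−1}): k = k′p+k₀ ↦ M−k = (M′−k′)p + (M₀−k₀) is a bijection between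
the ° cells of blocks k′ and M′−k′ with λ̃_{M−k} = λ̃_k (°), so W°(M′−k′) + W°(k′) = Σ_{k₀≤M₀} λ̃_k(g(M−k) + g(k)) ∈
p^ℓℤ_(p) … (D): … g(k*) ≡ g(k) (mod p^{e+1}) by (D)_{e+1} and λ̃_{k*} ≡ λ̃_k (mod p^{e+1}) by (°) … W°(k′*) ≡ W°(k′)
(mod p^{e+1})»; the full-kernel version (DIGIT THEOREM (a)(b): `u(n−j) = u(j)`, `λ_{n−j} = −λ_j`, exact
antisymmetry) is the case `ε = 1` of the same statements). Nothing here is about ζ(5); no irrationality content;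
filing moves no rung. Filed by the engine seat zi-eng (g9); inputs `BrickLambdaDigit` (LEMMA 3 (i)(iv)),
`BrickLambdaLocality` (LEMMA 3 (v)), `BrickResidueLawCirc.lambda_circ_le_one`, `BrickLevelReduction.blockWeight`.

## The statements (`p` odd prime, `A` even, `1 ≤ B`, `ε ≤ 1`, row `n = n₀ + Np`, `n₀ < p`, weight `g`)

Hypotheses on `g` on `[0, n]` at level `L+1`: (I) `g ∈ ℤ_(p)`; (S_ε) `v(g(n−k) + (−1)^ε g(k)) ≤ exp(−(L+1))`
(antisymmetric for the symmetric kernel, symmetric for the full kernel); (D) `v(g(k') − g(k)) ≤ exp(−e)` whenever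
`p^e ∣ k − k'`, `1 ≤ e ≤ L+1`. Conclusions for `W = blockWeight A B ε p n₀ N g`:
* **`blockWeight_le`**: `v(W(K)) ≤ exp(−1)` (`K ≤ N`);
* **`blockWeight_reflect_add_le`**: `v(W(N−K) + W(K)) ≤ exp(−(L+1))`;
* **`blockWeight_local`**: `v(W(K') − W(K)) ≤ exp(−(e+1))` for `K, K' ≤ N`, `p^e ∣ K − K'`, `1 ≤ e ≤ L`.
-/

namespace Summit.KontsevichZagierPeriods.Zeta5Search.BrickBlockWeight

open Finset Nat WithZero
open Summit.KontsevichZagierPeriods.Zeta5Search.BrickTopCoefficient (cTop)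
open Summit.KontsevichZagierPeriods.Zeta5Search.BrickLambda (cTop_zero_ne_zero padicValuation_two le_one_of_cong)
open Summit.KontsevichZagierPeriods.Zeta5Search.BrickResidueLawMain (cong_mul_le)
open Summit.KontsevichZagierPeriods.Zeta5Search.BrickDigitSide (le_exp_neg_one_of_lt_one)
open Summit.KontsevichZagierPeriods.Zeta5Search.BrickLambdaCirc (padicValuation_cTop_eq)
open Summit.KontsevichZagierPeriods.Zeta5Search.BrickResidueLawCirc (lambda_circ_le_one)
open Summit.KontsevichZagierPeriods.Zeta5Search.BrickLambdaDigit (cTop_reflect_le_one lambda_reflect sub_digit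
  lambda_congr_circ)
open Summit.KontsevichZagierPeriods.Zeta5Search.BrickLambdaLocality (lambda_digit_local_std)
open Summit.KontsevichZagierPeriods.Zeta5Search.BrickLevelReduction (blockWeight)
open Literature.NumberTheory.LFunctions (padicValuation_natCast_le_one)

noncomputable section

variable {p : ℕ} [Fact p.Prime]

/-- The top coefficient is `p`-integral (odd `p`): `v(cTop A B ε n k) ≤ 1`. -/
theorem padicValuation_cTop_le_one (hp2 : p ≠ 2) (A B ε n k : ℕ) : Rat.padicValuation p (cTop A B ε n k) ≤ 1 := by
  have hC : ∀ c : ℕ, Rat.padicValuation p (c : ℚ) ≤ 1 := fun c => padicValuation_natCast_le_one c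
  have hcen : Rat.padicValuation p ((n : ℚ) / 2 - k) ≤ 1 := by
    rw [show (n : ℚ) / 2 - k = (((n : ℤ) - 2 * k : ℤ) : ℚ) / 2 by push_cast; ring, map_div₀,
      padicValuation_two hp2, div_one, Rat.padicValuation_cast]
    exact Int.padicValuation_le_one _ _
  rw [padicValuation_cTop_eq]
  exact mul_le_one' (mul_le_one' (pow_le_one' hcen _) (pow_le_one' (hC _) _))
    (pow_le_one' (mul_le_one' (hC _) (hC _)) _)

section weight

variable (hp2 : p ≠ 2) {A B ε N n₀ L : ℕ} (hA : Even A) (hB : 1 ≤ B) (hε : ε ≤ 1) (hn₀ : n₀ < p)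
  {g : ℕ → ℚ} (hgI : ∀ k, k ≤ n₀ + N * p → Rat.padicValuation p (g k) ≤ 1)
  (hgS : ∀ k, k ≤ n₀ + N * p →
    Rat.padicValuation p (g (n₀ + N * p - k) + (-1) ^ ε * g k) ≤ exp (-((L : ℤ) + 1)))
  (hgD : ∀ e k k', 1 ≤ e → e ≤ L + 1 → k ≤ n₀ + N * p → k' ≤ n₀ + N * p → (p : ℤ) ^ e ∣ (k : ℤ) - k' →
    Rat.padicValuation p (g k' - g k) ≤ exp (-(e : ℤ)))
include hp2 hA hB hε hn₀ hgI hgS hgD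

omit hB hn₀ hgI in
/-- The one-digit sum `S₀ = Σ_{k₀≤n₀} g(k₀)·c_{k₀,A}(n₀)` is `≡ 0 (mod p)` (reflection `k₀ ↦ n₀ − k₀`: `c` picks up
`(−1)^ε`, `g(n₀−k₀) ≡ g(n−k₀) ≡ −(−1)^ε g(k₀)`; `p` odd). -/
theorem oneDigitSum_le :
    Rat.padicValuation p (∑ k₀ ∈ range (n₀ + 1), g k₀ * cTop A B ε n₀ k₀) ≤ exp (-1) := by
  have hp : p.Prime := Fact.out
  have hlt : exp (-((L : ℤ) + 1)) ≤ exp (-1 : ℤ) := by rw [exp_le_exp]; omega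
  set f : ℕ → ℚ := fun k₀ => g k₀ * cTop A B ε n₀ k₀ with hf
  set S₀ := ∑ k₀ ∈ range (n₀ + 1), f k₀ with hS₀
  -- `S₀ + S₀ = Σ (f(n₀ − k₀) + f(k₀))`
  have hrefl : S₀ + S₀ = ∑ k₀ ∈ range (n₀ + 1), (f (n₀ + 1 - 1 - k₀) + f k₀) := by
    rw [Finset.sum_add_distrib, Finset.sum_range_reflect]
  have hterm : ∀ k₀ ∈ range (n₀ + 1), Rat.padicValuation p (f (n₀ + 1 - 1 - k₀) + f k₀) ≤ exp (-1 : ℤ) := by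
    intro k₀ hk₀
    have hk₀' : k₀ ≤ n₀ := by have := mem_range.1 hk₀; omega
    have hk₀n : k₀ ≤ n₀ + N * p := by nlinarith
    rw [show n₀ + 1 - 1 - k₀ = n₀ - k₀ by omega, hf]
    simp only
    rw [cTop_reflect_le_one hA B hε hk₀',
      show g (n₀ - k₀) * ((-1) ^ ε * cTop A B ε n₀ k₀) + g k₀ * cTop A B ε n₀ k₀ =
        ((-1) ^ ε * (g (n₀ - k₀) - g (n₀ + N * p - k₀)) + (-1) ^ ε * (g (n₀ + N * p - k₀) + (-1) ^ ε * g k₀)) *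
          cTop A B ε n₀ k₀ by
        rcases Nat.le_one_iff_eq_zero_or_eq_one.1 hε with h | h <;> subst h <;> ring, map_mul]
    refine (mul_le_mul' (Valuation.map_add_le _ ?_ ?_) (padicValuation_cTop_le_one hp2 A B ε n₀ k₀)).trans
      (by rw [mul_one])
    · rw [map_mul, map_pow, Valuation.map_neg, map_one, one_pow, one_mul]
      refine hgD 1 (n₀ + N * p - k₀) (n₀ - k₀) le_rfl (by omega) (by omega) (by omega) ?_
      rw [pow_one, Nat.cast_sub (by omega : k₀ ≤ n₀ + N * p), Nat.cast_sub hk₀']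
      exact ⟨N, by push_cast; ring⟩
    · rw [map_mul, map_pow, Valuation.map_neg, map_one, one_pow, one_mul]
      exact (hgS k₀ hk₀n).trans hlt
  have h2 : Rat.padicValuation p (S₀ + S₀) ≤ exp (-1 : ℤ) := by
    rw [hrefl]; exact Valuation.map_sum_le _ hterm
  rwa [← two_mul, map_mul, padicValuation_two hp2, one_mul] at h2

/-- **`W(K) ≡ 0 (mod p)`** for every block `K ≤ N`: `W(K) ≡ S₀ ≡ 0` (LEMMA 3 (iv), (D)₁, and `oneDigitSum_le`). -/
theorem blockWeight_le {K : ℕ} (hK : K ≤ N) :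
    Rat.padicValuation p (blockWeight A B ε p n₀ N g K) ≤ exp (-1) := by
  have hp : p.Prime := Fact.out
  set S₀ := ∑ k₀ ∈ range (n₀ + 1), g k₀ * cTop A B ε n₀ k₀ with hS₀
  have hdiff : Rat.padicValuation p (blockWeight A B ε p n₀ N g K - S₀) ≤ exp (-1) := by
    rw [blockWeight, hS₀, ← Finset.sum_sub_distrib]
    refine Valuation.map_sum_le _ fun k₀ hk₀ => ?_
    have hk₀' : k₀ ≤ n₀ := by have := mem_range.1 hk₀; omega
    have hkn : k₀ + K * p ≤ n₀ + N * p := by nlinarith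
    refine cong_mul_le ?_ ?_ (hgI _ hkn) (padicValuation_cTop_le_one hp2 A B ε n₀ k₀)
    · refine hgD 1 k₀ (k₀ + K * p) le_rfl (by omega) (by omega) hkn ?_
      rw [pow_one]; exact ⟨-(K : ℤ), by push_cast; ring⟩
    · exact le_exp_neg_one_of_lt_one
        (lambda_congr_circ hp2 (A := A) (ε := ε) hB rfl rfl hn₀ hk₀' hK)
  have h := Valuation.map_add_le _ hdiff (oneDigitSum_le hp2 (B := B) hA hε hgS hgD)
  rwa [sub_add_cancel] at h

omit hB hgI hgD in
/-- **`W(N−K) + W(K) ≡ 0 (mod p^{L+1})`**: reflect the block `N−K` cell by cell (`λ_{n−k} = (−1)^ε λ_k`, LEMMA 3 (i))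
and use (S_ε). -/
theorem blockWeight_reflect_add_le {K : ℕ} (hK : K ≤ N) :
    Rat.padicValuation p (blockWeight A B ε p n₀ N g (N - K) + blockWeight A B ε p n₀ N g K) ≤
      exp (-((L : ℤ) + 1)) := by
  have hp : p.Prime := Fact.out
  rw [blockWeight, blockWeight, ← Finset.sum_range_reflect (fun k₀ => g (k₀ + (N - K) * p) * _) (n₀ + 1),
    ← Finset.sum_add_distrib]
  refine Valuation.map_sum_le _ fun k₀ hk₀ => ?_
  have hk₀' : k₀ ≤ n₀ := by have := mem_range.1 hk₀; omega
  have hkn : k₀ + K * p ≤ n₀ + N * p := by nlinarith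
  rw [show n₀ + 1 - 1 - k₀ = n₀ - k₀ by omega, ← sub_digit (p := p) hk₀' hK, lambda_reflect hA B hε hk₀' hK,
    show g (n₀ + N * p - (k₀ + K * p)) * ((-1) ^ ε * (cTop A B ε (n₀ + N * p) (k₀ + K * p) / cTop A B 0 N K)) +
        g (k₀ + K * p) * (cTop A B ε (n₀ + N * p) (k₀ + K * p) / cTop A B 0 N K) =
      ((-1) ^ ε * (cTop A B ε (n₀ + N * p) (k₀ + K * p) / cTop A B 0 N K)) *
        (g (n₀ + N * p - (k₀ + K * p)) + (-1) ^ ε * g (k₀ + K * p)) by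
      rcases Nat.le_one_iff_eq_zero_or_eq_one.1 hε with h | h <;> subst h <;> ring, map_mul, map_mul, map_pow,
    Valuation.map_neg, map_one, one_pow, one_mul]
  calc _ ≤ 1 * exp (-((L : ℤ) + 1)) :=
        mul_le_mul' (lambda_circ_le_one hp2 (A := A) (B := B) (ε := ε) rfl rfl hn₀ hk₀' hK
          (div_mul_cancel₀ _ (cTop_zero_ne_zero hK A B))) (hgS _ hkn)
    _ = _ := one_mul _

omit hB hε hgS in
/-- **`W(K') ≡ W(K) (mod p^{e+1})`** for blocks `K, K' ≤ N` with `p^e ∣ K − K'`, `1 ≤ e ≤ L` ((D)_{e+1} for `g`,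
LEMMA 3 (v) for `λ`). -/
theorem blockWeight_local {e K K' : ℕ} (he : 1 ≤ e) (heL : e ≤ L) (hK : K ≤ N) (hK' : K' ≤ N)
    (hdvd : (p : ℤ) ^ e ∣ (K : ℤ) - K') :
    Rat.padicValuation p (blockWeight A B ε p n₀ N g K' - blockWeight A B ε p n₀ N g K) ≤ exp (-((e : ℤ) + 1)) := by
  have hp : p.Prime := Fact.out
  -- without loss of generality `K ≤ K'`
  wlog hle : K ≤ K' generalizing K K'
  · rw [Valuation.map_sub_swap]
    exact this hK' hK (by rw [← neg_sub]; exact (dvd_neg).2 hdvd) (by omega)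
  obtain ⟨d, rfl⟩ := Nat.exists_eq_add_of_le hle
  obtain ⟨q, hq⟩ : p ^ e ∣ d := by
    have : (p : ℤ) ^ e ∣ (d : ℤ) := by
      have h := (dvd_neg).2 hdvd
      rw [neg_sub] at h; push_cast at h; rwa [add_sub_cancel_left] at h
    exact_mod_cast this
  rw [blockWeight, blockWeight, ← Finset.sum_sub_distrib]
  refine Valuation.map_sum_le _ fun k₀ hk₀ => ?_
  have hk₀' : k₀ ≤ n₀ := by have := mem_range.1 hk₀; omega
  have hkn : k₀ + K * p ≤ n₀ + N * p := by nlinarith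
  have hkn' : k₀ + (K + d) * p ≤ n₀ + N * p := by nlinarith
  refine cong_mul_le ?_ ?_ (hgI _ hkn') (lambda_circ_le_one hp2 (A := A) (B := B) (ε := ε) rfl rfl hn₀ hk₀' hK
    (div_mul_cancel₀ _ (cTop_zero_ne_zero hK A B)))
  · have := hgD (e + 1) (k₀ + K * p) (k₀ + (K + d) * p) (by omega) (by omega) hkn hkn' ?_
    · exact_mod_cast this
    · rw [hq]; push_cast
      exact ⟨-(q : ℤ), by ring⟩
  · have := lambda_digit_local_std hp2 (A := A) (B := B) (ε := ε) (e := e + 1) (q := q) hA hn₀ hk₀' hK hK'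
      (by rw [hq]; ring) (by omega) (div_mul_cancel₀ _ (cTop_zero_ne_zero hK A B))
      (div_mul_cancel₀ _ (cTop_zero_ne_zero hK' A B))
    exact_mod_cast this

end weight

end

end Summit.KontsevichZagierPeriods.Zeta5Search.BrickBlockWeight
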